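import Summits.BirchSwinnertonDyer.Rank1Residual.X4.KimShaLength
import Summits.BirchSwinnertonDyer.Rank1Residual.Additive.X4SharpThreeKimShape
import HarnessLib

/-!
# N11 — "Kim 2026 Thm. 1.8 (6) at `p = 3`" in the `∂`-EXACT shape: the hypothesis WITH its
# Tamagawa-obstructed rows, in the binder shape of `Additive/X4SharpThreeKimShape.lean`
# (cell `b2b-bsdres`, lane CLASS-CLOSURE, seat cc-typer-1 — typer ask T1; sibling of
# `X4/KimShaLength.lean`, whose §1–§2 hold the per-pair core `X4.KimShaLength[RankZero]At`)

HONEST FRAMING (cell `b2b-bsdres`, run/shared/lean/b2b/bsd-rank1-residual/, verbatim in every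
file): the goal of the cell is to DELETE the COMBINATION-SHAPED residual classes of the
Birch–Swinnerton-Dyer formula for ALL analytic-rank `≤ 1` elliptic curves over `ℚ` — "full BSD
formula for every rank `≤ 1` curve in class `C`" assembled STRICTLY from published theorems — so
that the rank-`≤ 1` remainder becomes exactly the CONSTRUCTION-SHAPED classes, which are TYPED
(missing-input `Prop`s), NOT attempted. This is not "finishing BSD". Lane CLASS-CLOSURE (coordinator
ruling 2026-08-21T04:07:19Z): research routes; no claim beyond stated classes; census output =
EVIDENCE / conjecture items with held-out validation, never a Literature fact; nothing below is
booked; the label X4 and the mark of RESIDUAL-MAP §I N11 are UNCHANGED by this file. NOTHING is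
asserted: `@[conjecture] def … : Prop` predicates and bookkeeping theorems.

## What this file types (team n1011 OWNERS T-a2 context; CLASS-CLOSURE-PLAN §3.1 E1/E2)

Team n1011's landed `Additive/X4SharpThreeKimShape.lean` (seat p03) types the N11 hypothesis in
Kim's two PRINTED binder shapes: `KimRankZeroBoundAt` (clause (6) as the certificate-free
INEQUALITY) and `KimRankZeroUnitBoundAt` (clauses (1)+(6) at a UNIT Kurihara number), with the
`5 ≤ p` binder removed and the TOWER binder added, and the conjectures `KimThree[Unit]`,
`X4SharpThreeKim[Unit]`. Here, on the `∂`-vocabulary of `KuriharaNumberInvariants` (p249101) and the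
per-pair core `X4.KimShaLengthRankZeroAt` of the sibling file:

* `KimRankZeroShaLengthAt W p` — clause (6) at the pair in its `∂`-EXACT shape: EXACTLY the binders of
  `KimRankZeroUnitBoundAt` minus the certificate (surj(p), tower, `L(E,1) ≠ 0`, `Ш` finite, datum `D`
  with `p ∤ c_D`, period transfer) ⟹ "`∂^{(∞)}(δ̃) = d ∈ ℕ` and `ord_p(L(E,1)/Ω(W)) = ord_p #Ш(E/ℚ)(p) + d`".
* `KimThreeShaLength := ∀ W, KimRankZeroShaLengthAt W 3` (every `E/ℚ`, as printed — no reduction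
  binder) and `X4SharpThreeKimShaLength` (restricted to an additive `3`) — the `∂`-exact twins of
  p03's `KimThree[Unit]` / `X4SharpThreeKim[Unit]`; PRE-REGISTRATION TARGET of CLASS-CLOSURE experiments
  X5/X6 'N11-KIM3' (EVIDENCE PENDING: the census report, sha and held-out score are appended here by
  the census typer when the fit is scored).
* RELATIONS (theorems): the `∂`-exact shape IMPLIES the unit shape
  (`kimRankZeroUnitBoundAt_of_kimRankZeroShaLengthAt`: a unit `δ̃_n` at a cyclic level forces
  `∂^{(∞)} = 0`), hence `KimThreeShaLength ⇒ KimThreeUnit`, `X4SharpThreeKimShaLength ⇒ X4SharpThreeKimUnit`,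
  and `KimThreeShaLength ⇒ X4SharpThreeKimShaLength`.
* WHAT `BSD(E,3)` BECOMES: `bsdp_three_iff_partialInfty_eq_of_x4SharpThreeKimShaLength` — GRANTED the
  `∂`-exact hypothesis, Miller's `BSD(E,3)` on an N11 tower row IS `∂^{(∞)}(δ̃) = ord₃ ∏_ℓ c_ℓ(E)`
  (FULL product, the additive `3` included) — the EXACT MISSING STATEMENT that experiment E1's
  "unit/Tamagawa normalisation at `3`" decides (team lead's KIM-AT-3-ANATOMY (δ) family S0–S5 are the
  candidate right-hand sides; team row T-N10C types Kim's Conjecture 1.9 itself); on a `3 ∤ ∏ c_ℓ` row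
  a unit certificate makes `BSD(E,3) ⟺ 3 ∤ ∏ c_ℓ` (`…_of_kuriharaUnitAt`, p03's LOWER lever read
  through the `∂`-exact shape); and the X4♯(3) inequality follows (`sha_le_three_of_…`).

STATUS: a THEOREM at `p ≥ 5` (Kim 2026) whose `∂`-exact shape is not a tree fact (only the unit and
inequality shapes are vendored); ANNOUNCED at `p ≥ 3` under large image — C.-H. Kim (app. R. Pollack),
arXiv:2505.09121 (2025, PRE) Thm. 1.1/1.2, on Sakamoto, JTNB 36 (2024) (team row T-a4 types the cited
OPEN record). The EXOTIC rows (surj(3) without the tower) and the non-surjective rows (O8) are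
outside every predicate below.

References: C.-H. Kim, Amer. J. Math. 148 (2026) = arXiv:2203.12159v4, Thm. 1.9 (1)(6), Conj. 1.10,
§1.2.5, §1.3.5, §1.5.1 [Kim2022StructureSelmer]; C.-H. Kim, arXiv:2505.09121 (PRE) Thm. 1.1/1.2,
§3.2.2; Miller 2011 Def. 1.1 [Miller2011LMS]; cell files CLASS-CLOSURE-PLAN.md §3.1,
cells/n1011/OWNERS.md (T-a2, T-a4, T-N10C), cells/n1011/KIM-AT-3-ANATOMY.md,
class-closure/N11/TYPED-TARGETS-cc-typer-1.md.
-/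

noncomputable section

open scoped Classical MatrixGroups ModularForm

open CongruenceSubgroup WeierstrassCurve Literature.NumberTheory.EllipticCurves
  Literature.NumberTheory.EllipticCurves.ModularForms
  Literature.NumberTheory.EllipticCurves.Rank1Residual
  Literature.NumberTheory.EllipticCurves.Rank1Residual.Typed


namespace Summit.BirchSwinnertonDyer.Rank1Residual.Additive

open Summit.BirchSwinnertonDyer.Rank1Residual.X4

/-- **Kim's clause (6) at the pair `(E, p)`, `∂`-EXACT shape** — the binders of
`KimRankZeroUnitBoundAt` (p03, `X4SharpThreeKimShape.lean`) WITHOUT the certificate: `ρ̄_{E,p}` onto,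
the tower `∀ n, ρ̄_{E,p^n}` onto, `L(E,1) ≠ 0`, `Ш(E/ℚ)` finite, a modular parametrisation datum `D`
with `p ∤ c_D`, the period transfer `Ω(W) = u·Ω⁺_{D.f}`, `|u|_p = 1` ⟹ `X4.KimShaLengthRankZeroAt W p D.f`
("`∂^{(∞)}(δ̃) = d ∈ ℕ` and `ord_p(L(E,1)/Ω(W)) = ord_p #Ш(E/ℚ)(p) + d`"). It implies the unit shape
(`kimRankZeroUnitBoundAt_of_kimRankZeroShaLengthAt`). A THEOREM at `p ≥ 5` (Kim 2026 Thm. 1.8 (6)) whose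
`∂`-exact shape is not a tree fact (only the unit / inequality shapes are); ANNOUNCED at `p ≥ 3` under
large image (Kim, arXiv:2505.09121 Thm. 1.1/1.2, PRE; OWNERS T-a4); the N11 hypothesis at `p = 3`.
A predicate; nothing asserted. [cite: Kim2022StructureSelmer, Thm. 1.9 (6) (PDF p. 8), §1.3.5 (PDF p. 6), §1.5.1 (PDF p. 7)] -/
@[conjecture] def KimRankZeroShaLengthAt (W : WeierstrassCurve ℚ) [W.IsElliptic] [W.IsGloballyMinimal]
    (p : ℕ) [Fact p.Prime] : Prop :=
  W.HasSurjectiveModNGaloisRep p → (∀ n : ℕ, W.HasSurjectiveModNGaloisRep (p ^ n : ℕ)) →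
    W.entireLFunction 1 ≠ 0 → Finite W.sha →
    ∀ {N : ℕ} [NeZero N] (D : ModularParametrizationData W N), ¬ (p : ℤ) ∣ D.maninConstant →
    (∃ u : ℚ, ‖(u : ℚ_[p])‖ = 1 ∧ W.realPeriodRat = u * plusPeriod D.f) →
    KimShaLengthRankZeroAt W p D.f

/-- **Conjecture `KimThreeShaLength` — "Kim 2026 Thm. 1.8 (6) remains valid at `p = 3`", `∂`-EXACT
shape**, for EVERY `E/ℚ` (no reduction binder, as printed), under `3`-adic tower surjectivity:
`∀ W, KimRankZeroShaLengthAt W 3`. The `∂`-exact twin of p03's `KimThree` / `KimThreeUnit`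
(implies the latter: `kimThreeUnit_of_kimThreeShaLength`). Kim §1.2.5 / arXiv:2505.09121 §3.2.2:
`p ≥ 5` enters only through Mazur–Rubin's Chebotarev argument ((H.4) "`Ā ≇ Ā*` or `p ≥ 5`", which
fails for `T₃E`: `E[3] ≅ E[3]^∨(1)`), repaired at `3` by Sakamoto (JTNB 36 (2024)). OPEN (ANNOUNCED,
PRE); nothing asserted. [cite: Kim2022StructureSelmer, Thm. 1.9 (6), §1.2.5 (PDF p. 5)] -/
@[conjecture] def KimThreeShaLength : Prop :=
  ∀ (W : WeierstrassCurve ℚ) [W.IsElliptic] [W.IsGloballyMinimal], KimRankZeroShaLengthAt W 3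

/-- **Conjecture X4♯(3)-Kim, `∂`-EXACT shape = THE N11 HYPOTHESIS with its Tamagawa-obstructed rows
INCLUDED**: `KimThreeShaLength` restricted to an ADDITIVE `3` (`Addv W 3`; with the predicate's surj(3)
binder this is the class `ClassX4 W 3`). On a row with `3 ∤ ∏ c_ℓ` a unit certificate reduces it to
p03's `X4SharpThreeKimUnit`; on a row with `3 ∣ ∏ c_ℓ` (TAM-DEFECT, where no unit can exist granted
BSD) it is the ONLY shape with content, and `bsdp_three_iff_partialInfty_eq_of_x4SharpThreeKimShaLength`
says what `BSD(E,3)` then IS. PRE-REGISTRATION TARGET of CLASS-CLOSURE experiments X5/X6 'N11-KIM3'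
(EVIDENCE PENDING — census report, sha and held-out score to be appended by the census typer).
OPEN; nothing asserted. [cite: Kim2022StructureSelmer, Thm. 1.9 (6) and §1.3.5 (shape only; the source proves p ≥ 5)] -/
@[conjecture] def X4SharpThreeKimShaLength : Prop :=
  ∀ (W : WeierstrassCurve ℚ) [W.IsElliptic] [W.IsGloballyMinimal],
    Addv W 3 → KimRankZeroShaLengthAt W 3

section Relations

variable (W : WeierstrassCurve ℚ) [W.IsElliptic] [W.IsGloballyMinimal] (p : ℕ) [Fact p.Prime]

/-- **The `∂`-exact shape implies the unit shape** (any `p`): a unit Kurihara number at a cyclic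
level forces `∂^{(∞)}(δ̃) = 0` (`kuriharaPartialInfty_eq_zero_of_ne_zero`), so `d = 0` and
`ord_p(L(E,1)/Ω(W)) = ord_p #Ш(E/ℚ)(p)`. [cite: Kim2022StructureSelmer, Thm. 1.9 (1) and (6) (PDF pp. 7–8), §1.5.1] -/
theorem kimRankZeroUnitBoundAt_of_kimRankZeroShaLengthAt (h : KimRankZeroShaLengthAt W p) :
    KimRankZeroUnitBoundAt W p := by
  intro hsurj htower hL hfin N _ D hc hper n _ hn hcyc ψ hψ hδ
  obtain ⟨q, d, hq, hd, hval⟩ := h hsurj htower hL hfin D hc hper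
  have h0 : kuriharaPartialInfty W p D.f = 0 :=
    kuriharaPartialInfty_eq_zero_of_ne_zero W p D.f ⟨hn, hcyc⟩ ψ hψ hδ
  have hd0 : d = 0 := by
    rw [h0] at hd
    exact_mod_cast hd.symm
  refine ⟨q, hq, ?_⟩
  rw [hval, hd0, Nat.cast_zero, add_zero]

/-- `KimThreeShaLength ⇒ KimThreeUnit` (p03's unit-shape conjecture at `3`). Bookkeeping.
[cite: Kim2022StructureSelmer, Thm. 1.9 (1) and (6) (PDF pp. 7–8)] -/
theorem kimThreeUnit_of_kimThreeShaLength (h : KimThreeShaLength) : KimThreeUnit :=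
  fun W _ _ => kimRankZeroUnitBoundAt_of_kimRankZeroShaLengthAt W 3 (h W)

/-- `X4SharpThreeKimShaLength ⇒ X4SharpThreeKimUnit` (p03's N11 hypothesis, unit shape). Bookkeeping.
[cite: Kim2022StructureSelmer, Thm. 1.9 (1) and (6) (PDF pp. 7–8)] -/
theorem x4SharpThreeKimUnit_of_x4SharpThreeKimShaLength (h : X4SharpThreeKimShaLength) :
    X4SharpThreeKimUnit :=
  fun W _ _ hadd => kimRankZeroUnitBoundAt_of_kimRankZeroShaLengthAt W 3 (h W hadd)

/-- `KimThreeShaLength ⇒ X4SharpThreeKimShaLength` (restriction to the additive rows). Bookkeeping.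
[cite: Kim2022StructureSelmer, Thm. 1.9 (6) (PDF p. 8)] -/
theorem x4SharpThreeKimShaLength_of_kimThreeShaLength (h : KimThreeShaLength) :
    X4SharpThreeKimShaLength :=
  fun W _ _ _ => h W

/-- **GRANTED the `∂`-exact N11 hypothesis, `BSD(E,3)` on an N11 tower row IS
`∂^{(∞)}(δ̃) = ord₃ ∏_ℓ c_ℓ(E)`** — the EXACT MISSING STATEMENT of class N11 given clause (6) at `3`,
per pair (GZK `hGZK` for `rank = r_an` and the finiteness of `Ш`; modularity `hmod` to read
`r_an = 0` as `L(E,1) ≠ 0`; surj(3) gives `E[3]` irreducible, so `3 ∤ #E(ℚ)_tors`). The product is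
the FULL Tamagawa product `W.tamagawaProduct`, the additive prime `3` included: any census-fitted
normalisation of Kim's Conjecture 1.9 at `3` (KIM-AT-3-ANATOMY (δ), family S0–S5) that differs from
`ord₃ ∏_ℓ c_ℓ` on a row where `BSD(E,3)` is known REFUTES the `∂`-exact hypothesis on that row.
[cite: Kim2022StructureSelmer, Thm. 1.9 (6) and Conj. 1.10 (PDF p. 8)] [cite: Miller2011LMS, Def. 1.1] -/
theorem bsdp_three_iff_partialInfty_eq_of_x4SharpThreeKimShaLength (h : X4SharpThreeKimShaLength)
    (hGZK : rank_eq_analyticRank_of_analyticRank_le_one) (hmod : hasEntireLFunction_rat)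
    (hr : W.analyticRank = 0) (hX : ClassX4 W 3)
    (hsurj : Surj W 3) (htower : ∀ n : ℕ, W.HasSurjectiveModNGaloisRep (3 ^ n : ℕ))
    {N : ℕ} [NeZero N] (D : ModularParametrizationData W N) (hc : ¬ (3 : ℤ) ∣ D.maninConstant)
    (hper : ∃ u : ℚ, ‖(u : ℚ_[3])‖ = 1 ∧ W.realPeriodRat = u * plusPeriod D.f) :
    BSDp W 3 ↔ kuriharaPartialInfty W 3 D.f = (padicValNat 3 W.tamagawaProduct : ℕ∞) := by
  have hL : W.entireLFunction 1 ≠ 0 := (W.analyticRank_eq_zero_iff_holds (hmod W)).mp hr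
  obtain ⟨hmw, hfin⟩ := hGZK W (by rw [hr]; exact zero_le_one)
  obtain ⟨q, d, hq, hd, hval⟩ := h W hX.2.1 hsurj htower hL hfin D hc hper
  rw [bsdp_iff_eq_tamagawa_of_rankZero_witness W 3 hmw hfin hL hX.2.2 hq hval, hd]
  exact ⟨fun h' => by rw [h'], fun h' => by exact_mod_cast h'⟩

/-- **Under the `∂`-exact hypothesis a unit certificate makes `BSD(E,3) ⟺ 3 ∤ ∏_ℓ c_ℓ(E)`** — the
`p = 3` port of `X4.bsdp_iff_not_dvd_tamagawaProduct_of_kuriharaUnitAt_of_analyticRank_eq_zero`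
(there `p ≥ 5` and Kim's theorem): the certificates remain instruments at `3`, closing exactly the
Tamagawa-prime rows (this is p03's LOWER lever read through the `∂`-exact shape).
[cite: Kim2022StructureSelmer, Thm. 1.9 (6) and Conj. 1.10 (PDF p. 8)] [cite: Miller2011LMS, Def. 1.1] -/
theorem bsdp_three_iff_not_dvd_tam_of_x4SharpThreeKimShaLength_of_kuriharaUnitAt
    (h : X4SharpThreeKimShaLength)
    (hGZK : rank_eq_analyticRank_of_analyticRank_le_one) (hmod : hasEntireLFunction_rat)
    (hr : W.analyticRank = 0) (hX : ClassX4 W 3)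
    (hsurj : Surj W 3) (htower : ∀ n : ℕ, W.HasSurjectiveModNGaloisRep (3 ^ n : ℕ))
    {N : ℕ} [NeZero N] (D : ModularParametrizationData W N) (hc : ¬ (3 : ℤ) ∣ D.maninConstant)
    (hper : ∃ u : ℚ, ‖(u : ℚ_[3])‖ = 1 ∧ W.realPeriodRat = u * plusPeriod D.f)
    (hK : KuriharaUnitAt W 3 D.f) : BSDp W 3 ↔ ¬ 3 ∣ W.tamagawaProduct := by
  have hL : W.entireLFunction 1 ≠ 0 := (W.analyticRank_eq_zero_iff_holds (hmod W)).mp hr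
  obtain ⟨hmw, hfin⟩ := hGZK W (by rw [hr]; exact zero_le_one)
  obtain ⟨n, hn0, hn, hcyc, ψ, hψ, hδ⟩ := hK
  haveI := hn0
  obtain ⟨q, hq, hval⟩ := kimRankZeroUnitBoundAt_of_kimRankZeroShaLengthAt W 3 (h W hX.2.1) hsurj
    htower hL hfin D hc hper n hn hcyc ψ hψ hδ
  exact bsdp_iff_not_dvd_tamagawaProduct_of_rankZero_witness W 3 hmw hfin hL hX.2.2 hq hval

/-- **The `∂`-exact hypothesis implies the X4♯(3) INEQUALITY on its rows**: `#Ш_an = q'` with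
`ord₃ #Ш(E/ℚ) ≤ ord₃ q' + ord₃ ∏_ℓ c_ℓ(E)` (the conclusion of `Additive.X4SharpThree`, here under the
tower and period binders). [cite: Kim2022StructureSelmer, Thm. 1.9 (6) (PDF p. 8)] [cite: Miller2011LMS, Def. 1.1] -/
theorem sha_le_three_of_x4SharpThreeKimShaLength (h : X4SharpThreeKimShaLength)
    (hGZK : rank_eq_analyticRank_of_analyticRank_le_one) (hmod : hasEntireLFunction_rat)
    (hr : W.analyticRank = 0) (hX : ClassX4 W 3)
    (hsurj : Surj W 3) (htower : ∀ n : ℕ, W.HasSurjectiveModNGaloisRep (3 ^ n : ℕ))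
    {N : ℕ} [NeZero N] (D : ModularParametrizationData W N) (hc : ¬ (3 : ℤ) ∣ D.maninConstant)
    (hper : ∃ u : ℚ, ‖(u : ℚ_[3])‖ = 1 ∧ W.realPeriodRat = u * plusPeriod D.f) :
    ∃ q' : ℚ, shaAn W = (q' : ℂ) ∧
      (padicValNat 3 W.shaOrder : ℤ) ≤ padicValRat 3 q' + padicValNat 3 W.tamagawaProduct := by
  have hL : W.entireLFunction 1 ≠ 0 := (W.analyticRank_eq_zero_iff_holds (hmod W)).mp hr
  obtain ⟨hmw, hfin⟩ := hGZK W (by rw [hr]; exact zero_le_one)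
  obtain ⟨q, d, hq, -, hval⟩ := h W hX.2.1 hsurj htower hL hfin D hc hper
  exact sha_le_of_rankZero_witness W 3 hmw hfin hL hq hval

end Relations

end Summit.BirchSwinnertonDyer.Rank1Residual.Additive

end
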